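import Mathlib
import Summits.MatrixMultiplication.MatrixMultiplication.Theses.LevelGradedCohnUmans

/-!
# `SnLevelDesigns` (stmt-MatrixMultiplication-7613), line `fixed-set-certificates`: stub `stub_fixedSetToken` — fixed-set polynomials are token functions

Crux `Summit.MatrixMultiplication.MatrixMultiplication.Theses.LevelGradedCohnUmans.SnLevelDesigns`; skeleton
`Cruxes/SnLevelDesigns/Lines/fixed_set_certificates.lean` (4 registered stubs); this file proves the registered
stub `stub_fixedSetToken` verbatim (name + signature, tree-only vocabulary: Mathlib only) and lands
`--supports stmt-MatrixMultiplication-7613`.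

Statement (the lever of the line): for `k ≤ n`, a weight `w : Finset (Fin n) → ℂ` supported on sets of
size `≤ k` and a target `t ∈ 𝔖ₙ`, the fixed-set polynomial `g ↦ ∑_{S ⊆ Fix(t⁻¹ g)} w S` is a `k`-token
function, i.e. of the form `g ↦ ∑_{p : Fin k → Fin n} c p (g ∘ p)`.

Proof: `Fix(t⁻¹ g) = {i | g i = t i}` (`fst_mem_fix_iff`).  Encode every non-empty `S` with `S.card ≤ k`
by a `k`-tuple `e S : Fin k → Fin n` whose range is exactly `S` (`fst_exists_enc`: list `S` increasingly
with `Finset.orderEmbOfFin` on the first `S.card` coordinates and pad with `S.min'`; empty / oversized sets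
get the harmless default tuple `Fin.castLE _ : Fin k → Fin n`, which is where `k ≤ n` enters), and put
`c p r := ∑_S [e S = p] · (if S = ∅ ∨ r = t ∘ p then w S else 0)`.
Interchanging the two finite sums (`Finset.sum_comm`) and collapsing the filter `[e S = p]`
(`Finset.sum_ite_eq_of_mem`), the `S`-term of `∑_p c p (g ∘ p)` is `w S` exactly when `S = ∅` or
`g ∘ e S = t ∘ e S`, i.e. (as `range (e S) = S`) exactly when `S ⊆ Fix(t⁻¹ g)`; oversized `S` contribute
`0` on both sides by the support hypothesis, and `∑_S [S ⊆ F] w S = ∑_{S ∈ F.powerset} w S`.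
-/

set_option linter.dupNamespace false

namespace Summit.MatrixMultiplication.MatrixMultiplication.Theorems.SnLevelDesigns

open scoped BigOperators

/-- Tuple encoding of small sets: for `k ≤ n` there is `e : Finset (Fin n) → (Fin k → Fin n)` such that
every non-empty `S` with `S.card ≤ k` is exactly the range of the `k`-tuple `e S` (the increasing listing
`S.orderEmbOfFin` on the first `S.card` coordinates, padded with `S.min'`; other sets get `Fin.castLE`). -/
theorem fst_exists_enc (n k : ℕ) (hkn : k ≤ n) :
    ∃ e : Finset (Fin n) → (Fin k → Fin n),
      ∀ S : Finset (Fin n), S.Nonempty → S.card ≤ k → ∀ i : Fin n, i ∈ S ↔ ∃ j : Fin k, e S j = i := by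
  classical
  refine ⟨fun S => if h : S.Nonempty then
      (fun j => if hj : (j : ℕ) < S.card then S.orderEmbOfFin rfl ⟨j, hj⟩ else S.min' h)
    else fun j => Fin.castLE hkn j, ?_⟩
  intro S hS hk i
  simp only [dif_pos hS]
  constructor
  · intro hi
    have hi' : i ∈ Set.range (S.orderEmbOfFin rfl) := by
      rw [Finset.range_orderEmbOfFin, Finset.mem_coe]
      exact hi
    obtain ⟨m, hm⟩ := hi'
    refine ⟨⟨m, lt_of_lt_of_le m.2 hk⟩, ?_⟩
    rw [dif_pos m.2]
    exact hm
  · rintro ⟨j, rfl⟩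
    by_cases hj : (j : ℕ) < S.card
    · rw [dif_pos hj]
      exact Finset.orderEmbOfFin_mem _ _ _
    · rw [dif_neg hj]
      exact Finset.min'_mem _ _

/-- The fixed points of `t⁻¹ * g` are exactly the places where `g` agrees with the target `t`. -/
theorem fst_mem_fix_iff {n : ℕ} (t g : Equiv.Perm (Fin n)) (i : Fin n) :
    i ∈ (Finset.univ.filter fun i : Fin n => (t⁻¹ * g) i = i) ↔ g i = t i := by
  rw [Finset.mem_filter, Equiv.Perm.mul_apply, Equiv.Perm.inv_eq_iff_eq]
  exact ⟨fun h => h.2, fun h => ⟨Finset.mem_univ _, h⟩⟩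

/-- **`stub_fixedSetToken`** (registered stub of crux stmt-MatrixMultiplication-7613, line
`fixed-set-certificates`; statement = `FixedSetToken` of the skeleton, tree-only vocabulary): for `k ≤ n`,
every fixed-set polynomial `g ↦ ∑_{S ⊆ Fix(t⁻¹ g)} w S` of subset-degree `≤ k` (`w S = 0` for
`k < S.card`) is a `k`-token function `g ↦ ∑_{p : Fin k → Fin n} c p (g ∘ p)`.  With the tuple encoding
`e` of `fst_exists_enc`, `c p r := ∑_S [e S = p] · (if S = ∅ ∨ r = t ∘ p then w S else 0)` works:
swap the sums, collapse `[e S = p]`, and read `g ∘ e S = t ∘ e S ↔ S ⊆ Fix(t⁻¹ g)` off `range (e S) = S`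
(`fst_mem_fix_iff`). -/
theorem stub_fixedSetToken :
    ∀ (n k : ℕ), k ≤ n → ∀ w : Finset (Fin n) → ℂ, (∀ S, k < S.card → w S = 0) →
      ∀ t : Equiv.Perm (Fin n), ∃ c : (Fin k → Fin n) → (Fin k → Fin n) → ℂ,
        ∀ g : Equiv.Perm (Fin n), (∑ p : Fin k → Fin n, c p (⇑g ∘ p)) =
          ∑ S ∈ (Finset.univ.filter fun i : Fin n => (t⁻¹ * g) i = i).powerset, w S := by
  intro n k hkn w hw t
  obtain ⟨e, he⟩ := fst_exists_enc n k hkn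
  refine ⟨fun p r => ∑ S : Finset (Fin n),
    if e S = p then (if S = ∅ ∨ r = ⇑t ∘ p then w S else 0) else 0, fun g => ?_⟩
  set F : Finset (Fin n) := Finset.univ.filter fun i : Fin n => (t⁻¹ * g) i = i
  have hpow : F.powerset = Finset.univ.filter (fun S => S ⊆ F) := by
    ext S
    simp only [Finset.mem_powerset, Finset.mem_filter, Finset.mem_univ, true_and]
  have key : ∀ S : Finset (Fin n), (∑ p : Fin k → Fin n,
      if e S = p then (if S = ∅ ∨ ⇑g ∘ p = ⇑t ∘ p then w S else 0) else 0) =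
      if S ⊆ F then w S else 0 := by
    intro S
    rw [Finset.sum_ite_eq_of_mem _ _ _ (Finset.mem_univ _)]
    rcases le_or_gt S.card k with hSk | hSk
    · rcases S.eq_empty_or_nonempty with rfl | hS
      · rw [if_pos (Or.inl rfl), if_pos (Finset.empty_subset _)]
      · have hiff : (S = ∅ ∨ ⇑g ∘ e S = ⇑t ∘ e S) ↔ S ⊆ F := by
          rw [or_iff_right hS.ne_empty, funext_iff]
          constructor
          · intro h i hi
            obtain ⟨j, rfl⟩ := (he S hS hSk i).1 hi
            exact (fst_mem_fix_iff t g _).2 (h j)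
          · intro h j
            exact (fst_mem_fix_iff t g _).1 (h ((he S hS hSk _).2 ⟨j, rfl⟩))
        exact if_congr hiff rfl rfl
    · rw [hw S hSk, ite_self, ite_self]
  calc (∑ p : Fin k → Fin n, ∑ S : Finset (Fin n),
        if e S = p then (if S = ∅ ∨ ⇑g ∘ p = ⇑t ∘ p then w S else 0) else 0)
      = ∑ S : Finset (Fin n), ∑ p : Fin k → Fin n,
        if e S = p then (if S = ∅ ∨ ⇑g ∘ p = ⇑t ∘ p then w S else 0) else 0 := Finset.sum_comm
    _ = ∑ S : Finset (Fin n), if S ⊆ F then w S else 0 := Finset.sum_congr rfl (fun S _ => key S)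
    _ = ∑ S ∈ Finset.univ.filter (fun S => S ⊆ F), w S := (Finset.sum_filter _ _).symm
    _ = ∑ S ∈ F.powerset, w S := by rw [hpow]

end Summit.MatrixMultiplication.MatrixMultiplication.Theorems.SnLevelDesigns
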